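import Mathlib
import Summits.ValiantsHypothesis.ValiantsHypothesis.Theorems.NewtonUnitEquationsDissociatedUniformTotalsLaw
import Summits.ValiantsHypothesis.ValiantsHypothesis.Theorems.NewtonUnitEquationsDissociatedUniformTotalsLawUnimodal
import Summits.ValiantsHypothesis.ValiantsHypothesis.Theorems.NewtonUnitEquationsDissociatedUniformTotalsLawUnimodalGraphs
import Summits.ValiantsHypothesis.ValiantsHypothesis.Theorems.NewtonUnitEquationsDissociatedUniformTotalsLawMultiplierParabola
import HarnessLib

/-!
# Crux `NewtonUnitEquations.DissociatedUniform` (stmt-ValiantsHypothesis-5905), `n = 3` totals law of model (Q**):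
# sampled cosines are cyclically unimodal (the engine for circles / regular polygons by name)

`cycUnimodal_mul_cos`: for every amplitude `A`, phase `α` and `q ≥ 1`, the label function
`k ↦ A·cos(α + 2π·k.val/q)` on `ℤ/q` is cyclically unimodal (`…TotalsLawUnimodal.CycUnimodal`).  Proof: reduce the phase modulo `2π`
and then, by a cyclic label shift (`CycUnimodal.comp_add_right`), to `α ∈ [0, 2π/q)`; there the angles `α + 2πk/q`, `k < q`, lie in
`[0, 2π)` and the sequence is V-shaped (decreasing while the angle is `≤ π`, increasing afterwards, two monotone runs glued by
`exists_valley_of_two_runs`, then g5's `cycUnimodal_of_valley`).  This is the scalar input for `…TotalsLawCircles` (circles, regular polygons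
and their chord curves are convexly ordered, hence covered BY NAME by the hodograph-convex totals law and its multiplier form).
Nothing here bears on `TotalsLawThree C` for arbitrary labellings (OPEN) or on VP ≠ VNP.
[folklore: cos is decreasing on [0, π] and increasing on [π, 2π]]
-/

set_option linter.dupNamespace false -- `ValiantsHypothesis.ValiantsHypothesis` (summit = problem) in every name

open scoped BigOperators Pointwise

namespace Summit.ValiantsHypothesis.ValiantsHypothesis.Theorems.NewtonUnitEquationsDissociatedUniform

namespace TotalsLaw

open Real

section Cosine

variable {q : ℕ} [NeZero q]

omit [NeZero q] in
/-- Cyclic unimodality is invariant under a cyclic shift of the labels. [folklore] -/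
theorem CycUnimodal.comp_add_right {f : ZMod q → ℝ} (hf : CycUnimodal f) (t : ZMod q) :
    CycUnimodal fun k => f (k + t) := by
  obtain ⟨n, d, hd, hasc, hdesc⟩ := hf
  refine ⟨n - t, d, hd, fun k hk => ?_, fun k hk hk1 => ?_⟩
  · have e1 : n - t + (k : ZMod q) + t = n + (k : ZMod q) := by ring
    have e2 : n - t + ((k + 1 : ℕ) : ZMod q) + t = n + ((k + 1 : ℕ) : ZMod q) := by ring
    show f (n - t + (k : ZMod q) + t) ≤ f (n - t + ((k + 1 : ℕ) : ZMod q) + t)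
    rw [e1, e2]; exact hasc k hk
  · have e1 : n - t + (k : ZMod q) + t = n + (k : ZMod q) := by ring
    have e2 : n - t + ((k + 1 : ℕ) : ZMod q) + t = n + ((k + 1 : ℕ) : ZMod q) := by ring
    show f (n - t + ((k + 1 : ℕ) : ZMod q) + t) ≤ f (n - t + (k : ZMod q) + t)
    rw [e1, e2]; exact hdesc k hk hk1

omit [NeZero q] in
/-- Scaling by a nonnegative constant keeps cyclic unimodality. [folklore] -/
theorem CycUnimodal.const_mul_nonneg {f : ZMod q → ℝ} (hf : CycUnimodal f) {A : ℝ} (hA : 0 ≤ A) :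
    CycUnimodal fun k => A * f k := by
  obtain ⟨n, d, hd, hasc, hdesc⟩ := hf
  exact ⟨n, d, hd, fun k hk => mul_le_mul_of_nonneg_left (hasc k hk) hA,
    fun k hk hk1 => mul_le_mul_of_nonneg_left (hdesc k hk hk1) hA⟩

/-- **Sampled cosine, small phase.**  For `0 ≤ α < 2π/q` the sequence `k ↦ cos(α + 2πk.val/q)` is cyclically unimodal (V-shaped on
`0, …, q−1`). [folklore] -/
theorem cycUnimodal_cos_of_small_phase {α : ℝ} (h0 : 0 ≤ α) (h1 : α < 2 * π / q) :
    CycUnimodal (fun k : ZMod q => Real.cos (α + 2 * π * (k.val : ℝ) / q)) := by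
  have hqpos : (0 : ℝ) < q := by exact_mod_cast Nat.pos_of_ne_zero (NeZero.ne q)
  have hπ := Real.pi_pos
  set g : ℕ → ℝ := fun k => Real.cos (α + 2 * π * (k : ℝ) / q) with hg
  have hfg : ∀ k, k < q → (fun z : ZMod q => Real.cos (α + 2 * π * (z.val : ℝ) / q)) (k : ZMod q) = g k := by
    intro k hk
    simp only [hg, ZMod.val_cast_of_lt hk]
  -- angles: `θ k = α + 2πk/q`; monotone in `k`, in `[0, 2π)` for `k < q`
  have θmono : ∀ k : ℕ, α + 2 * π * (k : ℝ) / q ≤ α + 2 * π * ((k + 1 : ℕ) : ℝ) / q := by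
    intro k
    have : (k : ℝ) ≤ ((k + 1 : ℕ) : ℝ) := by exact_mod_cast Nat.le_succ k
    have h2 : 2 * π * (k : ℝ) / q ≤ 2 * π * ((k + 1 : ℕ) : ℝ) / q :=
      div_le_div_of_nonneg_right (by nlinarith) hqpos.le
    linarith
  have θnn : ∀ k : ℕ, 0 ≤ α + 2 * π * (k : ℝ) / q := fun k => by positivity
  have θlt : ∀ k : ℕ, k + 1 ≤ q → α + 2 * π * (k : ℝ) / q < 2 * π := by
    intro k hk
    have hk' : (k : ℝ) + 1 ≤ q := by exact_mod_cast hk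
    have e : 2 * π * (k : ℝ) / q = 2 * π - 2 * π * ((q : ℝ) - k) / q := by field_simp; ring
    have h2 : 2 * π / q ≤ 2 * π * ((q : ℝ) - k) / q := by
      rw [div_le_div_iff_of_pos_right hqpos]; nlinarith
    rw [e]; linarith
  -- the junction: `J = ⌊(π - α) q / (2π)⌋₊`
  set x : ℝ := (π - α) * q / (2 * π) with hx
  set J : ℕ := ⌊x⌋₊ with hJ
  have hle_pi : ∀ k : ℕ, (k : ℝ) ≤ x → α + 2 * π * (k : ℝ) / q ≤ π := by
    intro k hk
    rw [hx, le_div_iff₀ (by positivity)] at hk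
    have : 2 * π * (k : ℝ) / q ≤ π - α := by
      rw [div_le_iff₀ hqpos]; linarith
    linarith
  have hge_pi : ∀ k : ℕ, x < (k : ℝ) → π ≤ α + 2 * π * (k : ℝ) / q := by
    intro k hk
    rw [hx, div_lt_iff₀ (by positivity)] at hk
    have : π - α ≤ 2 * π * (k : ℝ) / q := by
      rw [le_div_iff₀ hqpos]; linarith
    linarith
  have hJq : J < q := by
    by_contra hcon
    push Not at hcon
    rcases lt_or_ge x 0 with hxneg | hxnn
    · have : J = 0 := Nat.floor_of_nonpos hxneg.le
      have := NeZero.ne q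
      omega
    · have h1' : (J : ℝ) ≤ x := Nat.floor_le hxnn
      have h2' : (q : ℝ) ≤ J := by exact_mod_cast hcon
      have h3' : x < q := by
        rw [hx, div_lt_iff₀ (by positivity)]
        nlinarith
      linarith
  -- the two monotone runs
  obtain ⟨p, hp, hdesc, hasc⟩ := exists_valley_of_two_runs (q := q) g hJq
    (fun k hk => by
      -- `k + 1 ≤ J ≤ x`: both angles `≤ π`
      have hxnn : 0 ≤ x := by
        by_contra hneg
        push Not at hneg
        have : J = 0 := Nat.floor_of_nonpos hneg.le
        omega
      have hk1 : ((k + 1 : ℕ) : ℝ) ≤ x := le_trans (by exact_mod_cast hk) (Nat.floor_le hxnn)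
      exact Real.cos_le_cos_of_nonneg_of_le_pi (θnn k) (hle_pi (k + 1) hk1) (θmono k))
    (fun k hk hk1 => by
      -- `J + 1 ≤ k`: both angles `≥ π` and `< 2π`
      have hkx : x < (k : ℝ) := lt_of_lt_of_le (Nat.lt_floor_add_one x) (by exact_mod_cast hk)
      have hθk : π ≤ α + 2 * π * (k : ℝ) / q := hge_pi k hkx
      have hθk1 : α + 2 * π * ((k + 1 : ℕ) : ℝ) / q < 2 * π := θlt (k + 1) (by omega)
      have h := Real.cos_le_cos_of_nonneg_of_le_pi (x := 2 * π - (α + 2 * π * ((k + 1 : ℕ) : ℝ) / q))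
        (y := 2 * π - (α + 2 * π * (k : ℝ) / q)) (by linarith) (by linarith) (by linarith [θmono k])
      rwa [Real.cos_two_pi_sub, Real.cos_two_pi_sub] at h)
  exact cycUnimodal_of_valley _ g hfg hp hdesc hasc

/-- Reducing the phase: `cos(α + 2πv/q)` only depends on `v mod q`. [folklore] -/
theorem cos_phase_mod (α : ℝ) (v : ℕ) :
    Real.cos (α + 2 * π * (((v % q : ℕ)) : ℝ) / q) = Real.cos (α + 2 * π * (v : ℝ) / q) := by
  have hqpos : (0 : ℝ) < q := by exact_mod_cast Nat.pos_of_ne_zero (NeZero.ne q)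
  have hv : (v : ℝ) = ((v % q : ℕ) : ℝ) + (q : ℝ) * ((v / q : ℕ) : ℝ) := by exact_mod_cast (Nat.mod_add_div v q).symm
  rw [hv]
  have e : α + 2 * π * (((v % q : ℕ) : ℝ) + (q : ℝ) * ((v / q : ℕ) : ℝ)) / q =
      α + 2 * π * ((v % q : ℕ) : ℝ) / q + ((v / q : ℕ) : ℝ) * (2 * π) := by
    field_simp; ring
  rw [e, Real.cos_add_nat_mul_two_pi]

/-- **Sampled cosine, any phase**: `k ↦ cos(α + 2πk.val/q)` is cyclically unimodal on `ℤ/q`. [folklore] -/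
theorem cycUnimodal_cos (α : ℝ) : CycUnimodal (fun k : ZMod q => Real.cos (α + 2 * π * (k.val : ℝ) / q)) := by
  have hqpos : (0 : ℝ) < q := by exact_mod_cast Nat.pos_of_ne_zero (NeZero.ne q)
  have hπ := Real.pi_pos
  -- phase modulo `2π`: `α = α₁ + M·2π`, `α₁ ∈ [0, 2π)`
  set M : ℤ := ⌊α / (2 * π)⌋ with hM
  set α₁ : ℝ := α - M * (2 * π) with hα₁
  have hα₁0 : 0 ≤ α₁ := by
    have := Int.floor_le (α / (2 * π))
    rw [hα₁, hM]
    have : (⌊α / (2 * π)⌋ : ℝ) * (2 * π) ≤ α := by rwa [le_div_iff₀ (by positivity)] at this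
    linarith
  have hα₁1 : α₁ < 2 * π := by
    have := Int.lt_floor_add_one (α / (2 * π))
    rw [hα₁, hM]
    have : α < ((⌊α / (2 * π)⌋ : ℝ) + 1) * (2 * π) := by rwa [div_lt_iff₀ (by positivity)] at this
    linarith
  -- label shift: `u = α₁ q / (2π) ∈ [0, q)`, `N = ⌊u⌋₊`, `α' = α₁ - 2πN/q ∈ [0, 2π/q)`
  set u : ℝ := α₁ * q / (2 * π) with hu
  have hu0 : 0 ≤ u := by positivity
  have huq : u < q := by rw [hu, div_lt_iff₀ (by positivity)]; nlinarith
  set N : ℕ := ⌊u⌋₊ with hN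
  have hNq : N < q := by
    have : (N : ℝ) ≤ u := Nat.floor_le hu0
    exact_mod_cast this.trans_lt huq
  set α' : ℝ := α₁ - 2 * π * (N : ℝ) / q with hα'
  have hα'0 : 0 ≤ α' := by
    have : (N : ℝ) ≤ u := Nat.floor_le hu0
    rw [hu, le_div_iff₀ (by positivity)] at this
    have : 2 * π * (N : ℝ) / q ≤ α₁ := by rw [div_le_iff₀ hqpos]; linarith
    linarith
  have hα'1 : α' < 2 * π / q := by
    have : u < (N : ℝ) + 1 := Nat.lt_floor_add_one u
    rw [hu, div_lt_iff₀ (by positivity)] at this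
    rw [hα', lt_div_iff₀ hqpos]
    have e : (α₁ - 2 * π * (N : ℝ) / q) * q = α₁ * q - 2 * π * N := by field_simp
    rw [e]; linarith
  have hsmall := cycUnimodal_cos_of_small_phase (q := q) hα'0 hα'1
  have hshift := hsmall.comp_add_right (N : ZMod q)
  -- identify the shifted small-phase cosine with the original one
  refine (funext fun k => ?_ : (fun k : ZMod q => Real.cos (α' + 2 * π * (((k + (N : ZMod q)).val : ℕ) : ℝ) / q)) =
      fun k : ZMod q => Real.cos (α + 2 * π * (k.val : ℝ) / q)) ▸ hshift
  have hval : (k + (N : ZMod q)).val = (k.val + N) % q := by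
    rw [ZMod.val_add, ZMod.val_cast_of_lt hNq]
  rw [hval, cos_phase_mod]
  -- `α' + 2π(k.val + N)/q = α₁ + 2π k.val/q = α + 2πk.val/q - M·2π`
  have e : α' + 2 * π * ((k.val + N : ℕ) : ℝ) / q = α + 2 * π * (k.val : ℝ) / q + ((-M : ℤ) : ℝ) * (2 * π) := by
    rw [hα', hα₁]; push_cast; field_simp; ring
  rw [e, Real.cos_add_int_mul_two_pi]

/-- **Sampled cosine with amplitude**: `k ↦ A·cos(α + 2πk.val/q)` is cyclically unimodal for every real `A`. [folklore] -/
theorem cycUnimodal_mul_cos (A α : ℝ) : CycUnimodal (fun k : ZMod q => A * Real.cos (α + 2 * π * (k.val : ℝ) / q)) := by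
  rcases le_total 0 A with hA | hA
  · exact (cycUnimodal_cos α).const_mul_nonneg hA
  · have h := (cycUnimodal_cos (q := q) (α + π)).const_mul_nonneg (neg_nonneg.2 hA)
    refine (funext fun k => ?_ : (fun k : ZMod q => -A * Real.cos (α + π + 2 * π * (k.val : ℝ) / q)) =
        fun k : ZMod q => A * Real.cos (α + 2 * π * (k.val : ℝ) / q)) ▸ h
    rw [show α + π + 2 * π * (k.val : ℝ) / q = α + 2 * π * (k.val : ℝ) / q + π by ring, Real.cos_add_pi]
    ring

end Cosine

end TotalsLaw

end Summit.ValiantsHypothesis.ValiantsHypothesis.Theorems.NewtonUnitEquationsDissociatedUniform
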